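import Literature.Probability.Percolation.QuadCrossingFlip
import Literature.Probability.Percolation.QuadCrossingDualityConverse
import HarnessLib

/-!
# The rotated quad `(s, t) ↦ Q(1 - t, s)`: condition (3) of Lemma 6.1 is condition (2) after relabelling

Topic `Probability/Percolation`; proofs file towards the named fact `SchrammSmirnov2011_lemma_6_1`
(`QuadCrossingContinuity.lean`; O. Schramm, S. Smirnov, *On the scaling limits of planar
percolation*, Ann. Probab. 39 (2011), arXiv:1101.5820, proof of Lemma 6.1, p. 23: "the proof in
case (3) is symmetric to that of case (2)").

The symmetry is the relabelling `j ↦ j - 1` of the sides, realised by the rotation of the parameter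
square `Quad.rot Q := (s, t) ↦ Q(1 - t, s)`: `∂₀(rot Q) = ∂₁Q`, `∂₁(rot Q) = ∂₂Q`,
`∂₂(rot Q) = ∂₃Q`, `∂₃(rot Q) = ∂₀Q`, same carrier, `d₀ ↔ d₁` exchanged, same size parameter.
Consequently `Q.IsPerturbationThree Q' δ ↔ Q.rot.IsPerturbationTwo Q'.rot δ`
(`isPerturbationThree_iff_rot`), and the bad event of case (3), `⊞_Q ∖ ⊞_{Q'}`, is contained in
the case-(2)-shaped event for the rotated pair with OPEN crossings replaced by DUAL paths (paths in
the carrier avoiding the open edges and the drawn lattice points):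
`{⊞_Q} ∩ {¬⊞_{Q'}} ⊆ {dual crossing of rot Q' from ∂₀ to ∂₂} ∩ {no dual crossing of rot Q}`
(`crossed_and_not_crossed_subset_dual_rot`, by `Quad.exists_path_avoiding_of_not_exists_isCrossing`
and `Quad.not_exists_path_of_openCrossing_transversal`).  This is the exact reduction on which a
"lowest dual crossing" treatment of case (3) would start.  Everything is proved.

## References

* O. Schramm, S. Smirnov, Ann. Probab. 39 (2011) 1768–1814, arXiv:1101.5820, proof of Lemma 6.1.
  [SchrammSmirnov2011]
-/

noncomputable section

open scoped unitInterval
open Set Metric Function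
open Literature.Probability.LatticeModels

namespace Literature.Probability.Percolation

namespace QuadCrossing

namespace Quad

variable {D : Set ℂ}

/-- **The rotated quad** `(s, t) ↦ Q(1 - t, s)`. [cite: SchrammSmirnov2011, proof of Lemma 6.1] -/
def rot (Q : Quad D) : Quad D where
  toFun p := Q (σ p.2, p.1)
  continuous_toFun := Q.continuous_toFun.comp
    ((unitInterval.continuous_symm.comp continuous_snd).prodMk continuous_fst)
  injective_toFun p q h := by
    have := Q.injective_toFun h
    simp only [Prod.mk.injEq, unitInterval.symm_inj] at this
    exact Prod.ext this.2 this.1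
  range_subset := by
    rintro _ ⟨p, rfl⟩
    exact Q.range_subset ⟨(σ p.2, p.1), rfl⟩

/-- `rot_apply`: structural lemma for the definition above. [folklore] -/
@[simp] theorem rot_apply (Q : Quad D) (p : I × I) : Q.rot p = Q (σ p.2, p.1) := rfl

/-- The rotated quad has the same carrier. [folklore] -/
@[simp] theorem rot_carrier (Q : Quad D) : Q.rot.carrier = Q.carrier := by
  refine subset_antisymm ?_ ?_
  · rintro _ ⟨p, rfl⟩; exact ⟨(σ p.2, p.1), rfl⟩
  · rintro _ ⟨p, rfl⟩
    refine ⟨(p.2, σ p.1), ?_⟩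
    show Q (σ (σ p.1), p.2) = Q p
    rw [unitInterval.symm_symm]

/-- `∂₀(rot Q) = ∂₁Q`. [folklore] -/
@[simp] theorem rot_side_zero (Q : Quad D) : Q.rot.side 0 = Q.side 1 := by
  refine subset_antisymm ?_ ?_
  · rintro _ ⟨p, hp, rfl⟩
    exact ⟨(σ p.2, p.1), (show p.1 = 0 from hp), rfl⟩
  · rintro _ ⟨p, hp, rfl⟩
    refine ⟨(p.2, σ p.1), (show p.2 = 0 from hp), ?_⟩
    show Q (σ (σ p.1), p.2) = Q p
    rw [unitInterval.symm_symm]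

/-- `∂₂(rot Q) = ∂₃Q`. [folklore] -/
@[simp] theorem rot_side_two (Q : Quad D) : Q.rot.side 2 = Q.side 3 := by
  refine subset_antisymm ?_ ?_
  · rintro _ ⟨p, hp, rfl⟩
    exact ⟨(σ p.2, p.1), (show p.1 = 1 from hp), rfl⟩
  · rintro _ ⟨p, hp, rfl⟩
    refine ⟨(p.2, σ p.1), (show p.2 = 1 from hp), ?_⟩
    show Q (σ (σ p.1), p.2) = Q p
    rw [unitInterval.symm_symm]

/-- `∂₁(rot Q) = ∂₂Q`. [folklore] -/
@[simp] theorem rot_side_one (Q : Quad D) : Q.rot.side 1 = Q.side 2 := by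
  refine subset_antisymm ?_ ?_
  · rintro _ ⟨p, hp, rfl⟩
    refine ⟨(σ p.2, p.1), ?_, rfl⟩
    show σ p.2 = 1
    rw [show p.2 = 0 from hp, unitInterval.symm_zero]
  · rintro _ ⟨p, hp, rfl⟩
    refine ⟨(p.2, σ p.1), ?_, ?_⟩
    · show σ p.1 = 0
      rw [show p.1 = 1 from hp, unitInterval.symm_one]
    · show Q (σ (σ p.1), p.2) = Q p
      rw [unitInterval.symm_symm]

/-- `∂₃(rot Q) = ∂₀Q`. [folklore] -/
@[simp] theorem rot_side_three (Q : Quad D) : Q.rot.side 3 = Q.side 0 := by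
  refine subset_antisymm ?_ ?_
  · rintro _ ⟨p, hp, rfl⟩
    refine ⟨(σ p.2, p.1), ?_, rfl⟩
    show σ p.2 = 0
    rw [show p.2 = 1 from hp, unitInterval.symm_one]
  · rintro _ ⟨p, hp, rfl⟩
    refine ⟨(p.2, σ p.1), ?_, ?_⟩
    · show σ p.1 = 1
      rw [show p.1 = 0 from hp, unitInterval.symm_zero]
    · show Q (σ (σ p.1), p.2) = Q p
      rw [unitInterval.symm_symm]

/-- `d₀(rot Q) = d₁(Q)`. [folklore] -/
theorem rot_sideDist_zero (Q : Quad D) : Q.rot.sideDist 0 = Q.sideDist 1 := by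
  simp only [sideDist, rot_carrier, rot_side_zero, show ((0 : Fin 4) + 2) = 2 from rfl,
    rot_side_two, show ((1 : Fin 4) + 2) = 3 from rfl]

/-- `d₁(rot Q) = d₀(Q)` (paths reversed). [folklore] -/
theorem rot_sideDist_one (Q : Quad D) : Q.rot.sideDist 1 = Q.sideDist 0 := by
  simp only [sideDist, rot_carrier, rot_side_one, show ((1 : Fin 4) + 2) = 3 from rfl,
    rot_side_three, show ((0 : Fin 4) + 2) = 2 from rfl]
  congr 1
  ext r
  constructor
  · rintro ⟨x, hx, y, hy, γ, hγ, hr⟩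
    exact ⟨y, hy, x, hx, γ.symm, by rwa [Path.symm_range], by rwa [Path.symm_range]⟩
  · rintro ⟨x, hx, y, hy, γ, hγ, hr⟩
    exact ⟨y, hy, x, hx, γ.symm, by rwa [Path.symm_range], by rwa [Path.symm_range]⟩

/-- The size parameter is unchanged. [folklore] -/
theorem rot_sizeParam (Q : Quad D) : Q.rot.sizeParam = Q.sizeParam := by
  simp only [sizeParam, rot_sideDist_zero, rot_sideDist_one, max_comm]

/-- Short junctions are unchanged (same carrier). [folklore] -/
theorem rot_shortJoin_iff (Q : Quad D) (δ : ℝ) (x : ℂ) (T : Set ℂ) :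
    Q.rot.ShortJoin δ x T ↔ Q.ShortJoin δ x T := by
  simp only [ShortJoin, rot_carrier]

/-- **Condition (3) is condition (2) for the rotated pair.** [cite: SchrammSmirnov2011, proof of Lemma 6.1, case (3)] -/
theorem isPerturbationThree_iff_rot (Q Q' : Quad D) (δ : ℝ) :
    Q.IsPerturbationThree Q' δ ↔ Q.rot.IsPerturbationTwo Q'.rot δ := by
  simp only [IsPerturbationThree, IsPerturbationTwo, rot_carrier, rot_side_zero, rot_side_one,
    rot_side_two, rot_side_three, rot_shortJoin_iff]
  tauto

/-- **The bad event of case (3) inside the dual picture of the rotated pair.**  If `Q` is crossed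
inside the open edges `O` and `Q'` is not (`δ > 0` the mesh), then `rot Q'` has a dual crossing
(a path in `[Q']` from `∂₀(rot Q') = ∂₁Q'` to `∂₂(rot Q') = ∂₃Q'` avoiding `O` and the drawn lattice
points) while `rot Q` has no dual path from `∂₀(rot Q)` to `∂₂(rot Q)` avoiding `O`.
[cite: SchrammSmirnov2011, proof of Lemma 6.1, case (3)] -/
theorem crossed_and_not_crossed_subset_dual_rot (Q Q' : Quad D) {δ : ℝ} (hδ : 0 < δ)
    {ω : BondConfig (Site 2)} (hQ : ∃ K, Q.IsCrossing K ∧ K ⊆ openEdgeUnion δ ω)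
    (hQ' : ¬ ∃ K, Q'.IsCrossing K ∧ K ⊆ openEdgeUnion δ ω) :
    (∃ β : ℝ → ℂ, ContinuousOn β (Icc 0 1) ∧ MapsTo β (Icc 0 1) Q'.rot.carrier ∧
        β 0 ∈ Q'.rot.side 0 ∧ β 1 ∈ Q'.rot.side 2 ∧ ∀ t ∈ Icc (0 : ℝ) 1,
          β t ∉ openEdgeUnion δ ω ∧ β t ∉ range (meshPoint δ)) ∧
      ¬ ∃ γ : ℝ → ℂ, ContinuousOn γ (Icc 0 1) ∧ MapsTo γ (Icc 0 1) Q.rot.carrier ∧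
        γ 0 ∈ Q.rot.side 0 ∧ γ 1 ∈ Q.rot.side 2 ∧ ∀ t ∈ Icc (0 : ℝ) 1,
          γ t ∉ openEdgeUnion δ ω := by
  constructor
  · obtain ⟨β, hβc, hβm, hβ0, hβ1, hβO⟩ := Q'.exists_path_avoiding_of_not_exists_isCrossing hδ hQ'
    refine ⟨β, hβc, ?_, ?_, ?_, hβO⟩
    · rw [rot_carrier]; exact hβm
    · rw [rot_side_zero]; exact hβ0
    · rw [rot_side_two]; exact hβ1
  · obtain ⟨K, ⟨hKc, hKconn, hKsub, hK0, hK2⟩, hKO⟩ := hQ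
    have := Q.rot.not_exists_path_of_openCrossing_transversal hKc hKconn.isPreconnected
      (by rw [rot_carrier]; exact hKsub) hKO (by rw [rot_side_one]; exact hK2)
      (by rw [rot_side_three]; exact hK0)
    exact this

end Quad

end QuadCrossing

end Literature.Probability.Percolation
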